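import Summits.Ventures.DiscreteObjects.Hadamard.GSRowSums167

/-!
# Hadamard 668 census — completeness of the row-sum grammar: the ten types of `668` as a sum of four odd squares

Framing: lottery ticket; floor = certified bounds/negative ranges.

Cell pub-namedobj (venture DiscreteObjects), target (H).  `GSRowSums167` proves that the row sums `Σa, Σb, Σc, Σd` of a
Goethals–Seidel quadruple over `ZMod 167` are odd with squares summing to `668`.  This file certifies the census's
parameter table (PLAN-H §2 / TABLE-H): the multiset of absolute row sums is one of exactly TEN types
`{25,5,3,3}, {23,11,3,3}, {23,9,7,3}, {21,15,1,1}, {21,13,7,3}, {21,11,9,5}, {19,17,3,3}, {19,15,9,1}, {17,17,9,3}, {15,15,13,7}`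
(`gs167_rowsum_type`; the arithmetic enumeration `four_odd_squares_668` is a kernel `decide` over the `13⁴` odd
candidates below `26`).  Each type is one sub-row of the four-circulant family (SDS parameters `kᵢ = (167 - xᵢ)/2` up to
sign).  Ours; no `sorry`, no `native_decide`.
-/

open Finset BigOperators

namespace Summit.Ventures.DiscreteObjects.Hadamard

/-- the odd naturals below 26 -/
def odds26 : List ℕ := [1, 3, 5, 7, 9, 11, 13, 15, 17, 19, 21, 23, 25]

/-- the ten types of `668` as a sum of four odd squares, each sorted decreasingly -/
def types668 : List (List ℕ) :=
  [[25, 5, 3, 3], [23, 11, 3, 3], [23, 9, 7, 3], [21, 15, 1, 1], [21, 13, 7, 3], [21, 11, 9, 5], [19, 17, 3, 3],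
   [19, 15, 9, 1], [17, 17, 9, 3], [15, 15, 13, 7]]

set_option maxRecDepth 100000 in
set_option maxHeartbeats 40000000 in
/-- arithmetic enumeration (kernel): four odd naturals below 26 whose squares sum to 668 form one of the ten types -/
theorem four_odd_squares_668 : ∀ w ∈ odds26, ∀ x ∈ odds26, ∀ y ∈ odds26, ∀ z ∈ odds26,
    w ^ 2 + x ^ 2 + y ^ 2 + z ^ 2 = 668 → ([w, x, y, z].insertionSort (· ≥ ·)) ∈ types668 := by
  decide

/-- every type in the list does occur (the enumeration is exact, not just an upper bound) -/
theorem types668_realised : ∀ t ∈ types668, (t.map (· ^ 2)).sum = 668 ∧ ∀ u ∈ t, u ∈ odds26 := by decide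

/-- an odd natural number with square at most 668 is in `odds26` -/
lemma mem_odds26 (n : ℕ) (hodd : Odd n) (hsq : n ^ 2 ≤ 668) : n ∈ odds26 := by
  have hn : n < 26 := by nlinarith
  interval_cases n <;> simp_all [odds26] <;> exact absurd hodd (by decide)

/-- the absolute value of an odd integer row sum with square at most 668 is in `odds26` -/
lemma natAbs_mem_odds26 (s : ℤ) (hodd : Odd s) (hsq : s ^ 2 ≤ 668) : s.natAbs ∈ odds26 := by
  apply mem_odds26
  · exact Int.natAbs_odd.mpr hodd
  · have : (s.natAbs : ℤ) ^ 2 = s ^ 2 := Int.natAbs_pow_two s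
    exact_mod_cast this ▸ hsq

/-- **Completeness of the census grammar.** For any Goethals–Seidel quadruple over `ZMod 167` the absolute row sums,
sorted, form one of the ten types of `types668`. -/
theorem gs167_rowsum_type (a b c d : ZMod 167 → ℤ) (h : GSQuad a b c d) :
    ([(∑ i, a i).natAbs, (∑ i, b i).natAbs, (∑ i, c i).natAbs, (∑ i, d i).natAbs].insertionSort (· ≥ ·))
      ∈ types668 := by
  obtain ⟨hsq, hoa, hob, hoc, hod⟩ := gs167_rowsums a b c d h
  have pa := sq_nonneg (∑ i, a i); have pb := sq_nonneg (∑ i, b i)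
  have pc := sq_nonneg (∑ i, c i); have pd := sq_nonneg (∑ i, d i)
  refine four_odd_squares_668 _ (natAbs_mem_odds26 _ hoa (by linarith)) _ (natAbs_mem_odds26 _ hob (by linarith))
    _ (natAbs_mem_odds26 _ hoc (by linarith)) _ (natAbs_mem_odds26 _ hod (by linarith)) ?_
  zify
  simp only [sq_abs]
  exact hsq

end Summit.Ventures.DiscreteObjects.Hadamard
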